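import Literature.AlgebraicGeometry.Hyperkaehler.KugaSatakeCorrespondenceHyperkaehler
import Literature.AlgebraicGeometry.Hyperkaehler.GeneralizedKummerType
import HarnessLib

/-!
# The Kuga–Satake correspondence of a projective `Kumⁿ`-type variety is algebraic (Voisin 2022, Thm. 1.5 = Thm. 4.1; Floccari 2024 §5, Floccari 2026 §3.3) — NAMED FACT

Layer `Literature/AlgebraicGeometry/Hyperkaehler`.  CITE record for the cross-ladder literature-typing layer
(D-0088(4), tranche LT-H4 "open-question harvest", seat `hodge-lit-oqh-2`): the ONE deformation type of
projective hyperkähler varieties of dimension `2n ≥ 4` for which the Kuga–Satake Hodge conjecture — the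
property `Hyperkaehler.IsKSCorrespondenceAlgebraicHK n hX` of the companion definitions file
`Hyperkaehler/KugaSatakeCorrespondenceHyperkaehler` (Floccari's formulation: an algebraic cycle on
`X × KS(X) × KS(X)` inducing the Kuga–Satake embedding of `(H²_tr(X, ℚ), q_X)`) — is a THEOREM in print:
the generalized Kummer deformation type `Kumⁿ`, `n ≥ 2` (Voisin 2022).  The summit-side conjecture leaf
typed by this seat (`KSH_Hyperkaehler`, staged) asks the property for every projective irreducible
symplectic `X`; this file records, BY NAME and in the same predicate, the part of it that is settled.

## Sources (read at source; locators = files of the materialised arXiv texts)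

* [Voi22] C. Voisin, *Footnotes to papers of O'Grady and Markman*, Math. Z. 300 (2022) 3405–3416
  (arXiv:2106.06979) [`Voisin2022FootnotesOGradyMarkman`; REFEREED].  **Theorem 1.5**
  [corpus:paper-arxiv-2106.06979 p0004:L14], verbatim: "For `X` a projective hyper-Kähler manifold of
  generalized Kummer deformation type with `n ≥ 2`, the Kuga-Satake correspondence between `X` and its
  Kuga-Satake variety `KS(X)` is algebraic."  Explanation [p0004:L16–L18]: "the Kuga-Satake construction
  in the polarized case produces an abelian variety `KS(X)` associated to the polarized Hodge structure
  `(H²(X,ℚ)_tr, ( , ))` which has the property that `H²(X,ℚ)_tr` is a Hodge substructure of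
  `H²(KS(X),ℚ)`. The Hodge conjecture predicts the existence of a correspondence between `X` and `KS(X)`,
  that is an algebraic cycle `Γ` of codimension `2n` with `ℚ`-coefficients in `X × KS(X)`, such that `Γ_*`
  induces the given embedding `H²(X,ℚ)_tr ↪ H²(KS(X),ℚ)`. The meaning of the 'algebraicity of the
  Kuga-Satake correspondence' is the existence of such cycle `Γ` (see [van Geemen] for a general
  discussion)."  Restated and proved as **Theorem 4.1** [p0010:L38]: "Let `X` be a projective
  hyper-Kähler manifold of generalized Kummer type. Then the Kuga-Satake correspondence of `X` is
  algebraic." (§4 definition of the property: [p0010:L9–L29]; proof from Markman's Abel–Jacobi theorem,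
  the algebraicity of the class `Q_X` and Claim 4.3, [p0010:L52]–[p0011:L19]; the `J³(X)`-form of that
  proof is the tree's record `Hyperkaehler.OGradyVoisin2022_thirdJacobian_kugaSatake_kummerType`.)
* [Flo26] S. Floccari, *K3 surfaces associated with varieties of generalized Kummer type*, Geom. Topol.
  30 (2026) 1129–1154 (arXiv:2501.02315) [`Floccari2026`; REFEREED], §3.3, the sentence after
  Conjecture 3.3 (the Kuga–Satake Hodge conjecture, `μ'` induced by an algebraic cycle on `S × KS(S)²`,
  stated for "a polarized K3 surface or hyper-Kähler variety") [corpus:paper-arxiv-2501.02315 p0007:L48],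
  verbatim: "The Kuga-Satake Hodge conjecture has been proven for all hyper-Kähler varieties of
  generalized Kummer type by Markman [Mar23] and Voisin [Voi22]."; Remark 3.4 [p0007:L51]: the
  `H²_prim`-form "is equivalent to the statement that the embedding
  `μ' : H²_tr(S,ℚ) ↪ H¹(KS'(S),ℚ)^{⊗2} ⊂ H²(KS'(S)²,ℚ)` … is induced by an algebraic cycle" (`KS'` built
  from `H²_tr`); §1 [p0003:L38]: "his results further imply that the Kuga-Satake correspondence is
  algebraic for any variety of `Kumⁿ`-type, as shown by Voisin"; proof of Thm. 5.10 [p0018:L24]: "The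
  Kuga-Satake Hodge conjecture (Conjecture 3.3) holds for `K` by [Voi22]."
* [Flo24] S. Floccari, *Sixfolds of generalized Kummer type and K3 surfaces*, Compos. Math. 160 (2024)
  388–410 (arXiv:2210.02948) [`Floccari2024`; REFEREED], §5.1 Conjecture (Kuga–Satake Hodge conjecture:
  "an algebraic cycle `ζ` on `X × KS(X) × KS(X)` such that … `ζ_* : H²_tr(X) ↪ H²(KS(X) × KS(X))`",
  `KS(X)` built from `(H²_tr(X), q_X)`) [corpus:paper-arxiv-2210.02948 p0016:L54–L61] — THE formulation
  rendered by `IsKSCorrespondenceAlgebraicHK` — and the proof of the §5.1 Theorem (= Thm. 3 of the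
  Introduction) [p0017:L60], verbatim: "The Kuga-Satake Hodge conjecture holds for `K` by
  [voisinfootnotes]." (`K` any projective variety of `Kum³`-type); §1 [p0004:L1]: "the validity of the
  Kuga-Satake Hodge conjecture for varieties of `Kumⁿ`-type, established by Voisin [Voi22] as a
  consequence of results of O'Grady [O'G21] and Markman [Mar23]".

## Rendering (tree carriers) and faithfulness

* "projective hyper-Kähler manifold of generalized Kummer deformation type, `n ≥ 2`" (dimension `2n`):
  `2 ≤ n`, `hX : Motives.IsSmoothProjective (2 * n) X`, `IsOfGeneralizedKummerType n X` (file
  `GeneralizedKummerType`) — the binders of every `Kumⁿ` record of this layer.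
* "the Kuga–Satake correspondence of `X` is algebraic": `IsKSCorrespondenceAlgebraicHK n hX` — Floccari's
  `H²_tr`-form on the real carriers (module docstring of `KugaSatakeCorrespondenceHyperkaehler`, items
  1–6: for every Fujiki form, Hodge model, presentation of `(H²_tr(X, ℚ), q_X)`, van Geemen choices and
  Kuga–Satake variety `(A, B, θ)`, an algebraic correspondence `H²(X(ℂ); ℂ) → H²((A × A)(ℂ); ℂ)`
  restricting to the complexified Kuga–Satake class map).  [Voi22] Thm. 1.5 is printed in the
  `H²_tr`-form with target `H²(KS(X), ℚ)`; §4 works with `H²_prim` and `( , )_lef`; [Flo24]/[Flo26] print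
  the `H²_tr`-form with target `H²(KS(X) × KS(X), ℚ)` and state that the conjecture in THAT form holds for
  `Kumⁿ`-type by [Voi22] ([Flo26] Rem. 3.4: the forms are equivalent; [Flo24] Remark before the
  Conjecture: rescaling `q` or passing to `H²_tr ⊂ H²_prim` gives isogenous Kuga–Satake varieties).  So the
  assertion below is the sentence printed in three refereed sources, in the formulation two of them print;
  the universal quantification over the choices inside the predicate is classically immaterial (Varesco
  2023 Rem. 4.3, quoted in the definitions file).
* Scope note (a located nuance, not a correction): [Voi22]'s printed argument identifies `J³(X)` with a
  component of `KS(X)` through the universality of the Kuga–Satake construction (Thm. 3.1, Mumford–Tate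
  group `SO`; Thm. 1.1 (2) "for a very general projective deformation"), while Thm. 1.5/4.1 and the
  sentences of [Flo24]/[Flo26] are printed for EVERY projective `X` of the type; the record follows print.
  Grade: REFEREED (Math. Z. 2022; Compos. Math. 2024; Geom. Topol. 2026).

## Content and D-0026 accounting

One named fact (+1; a refereed published theorem, cited at the line; `lean search` for
`IsKSCorrespondenceAlgebraicHK|Voisin2022|kugaSatake.*kummer` finds only the definitions file and the
`J³(X)`-form record `OGradyVoisin2022_thirdJacobian_kugaSatake_kummerType`, which does not mention
Kuga–Satake varieties): `Voisin2022_kugaSatakeCorrespondence_algebraic_kummerType`.  Kernel: the `Kum³`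
(sixfold) and `Kum⁴` (eightfold) spellings.  HONEST FRAMING: nothing here asserts the Hodge conjecture
for any variety; typed ≠ proved.

## Not here

The Kuga–Satake Hodge conjecture for other deformation types (open: K3 surfaces in general, `K3^[n]`
"has not been proven" (Varesco 2023 §5), OG10; the summit-side leaf `KSH_Hyperkaehler`); O'Grady's
`KS(X,L) ~ J³(X)⁴` (IMRN 2021 Thm. 1.5, proved through universality for Mumford–Tate group `SO` —
[Voi22] Thm. 1.1 (2) "very general"; no `very general` carrier is used here); any proof.
-/

noncomputable section

namespace Literature.AlgebraicGeometry.Hyperkaehler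

open HodgeTheory
open Motives (SchemeOver IsSmoothProjective)

/-- **Voisin 2022, Theorem 1.5 (= Theorem 4.1): for every smooth projective complex variety `X` of
`Kumⁿ`-type, `n ≥ 2`, the Kuga–Satake correspondence of `X` is algebraic** ("For `X` a projective
hyper-Kähler manifold of generalized Kummer deformation type with `n ≥ 2`, the Kuga-Satake correspondence
between `X` and its Kuga-Satake variety `KS(X)` is algebraic"; Floccari 2026 §3.3: "[this statement] has
been proven for all hyper-Kähler varieties of generalized Kummer type by Markman and Voisin"; Floccari
2024 §5, proof of the §5.1 Theorem: "[it] holds for `K` by [Voi22]" — the printed sentences, with the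
papers' name for the statement, are in the module docstring).  Rendering (module docstring): the tree's
property `IsKSCorrespondenceAlgebraicHK n hX` (Floccari's `H²_tr`-form: an algebraic cycle on
`X × KS(X) × KS(X)` inducing the Kuga–Satake embedding of `(H²_tr(X, ℚ), q_X)`, for all the classically
immaterial choices) for `2 ≤ n`, `hX : IsSmoothProjective (2 * n) X`, `IsOfGeneralizedKummerType n X`.
A THEOREM in print (status: proved; REFEREED: Math. Z. 2022, as used in Compos. Math. 2024 and Geom.
Topol. 2026; unproved in the tree; printed proof via Markman's Abel–Jacobi theorem and the universality
of the Kuga–Satake construction, see the scope note in the module docstring).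
[cite: Voisin2022FootnotesOGradyMarkman, Thm. 1.5 (§1, arXiv p. 3) = Thm. 4.1 (§4, arXiv p. 9)]
[cite: Floccari2026, §3.3 (sentence after 3.3) and Rem. 3.4; proof of Thm. 5.10]
[cite: Floccari2024, §5.1 (statement 29 of the arXiv text) and the proof of the §5.1 Theorem (= Introduction Thm. 3)] -/
def Voisin2022_kugaSatakeCorrespondence_algebraic_kummerType : Prop :=
  ∀ (n : ℕ), 2 ≤ n → ∀ ⦃X : SchemeOver ℂ⦄ (hX : IsSmoothProjective (2 * n) X),
    IsOfGeneralizedKummerType n X → IsKSCorrespondenceAlgebraicHK n hX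

namespace Voisin2022_kugaSatakeCorrespondence_algebraic_kummerType

/-- The `Kum³`-type spelling (projective hyperkähler SIXFOLDS of generalized Kummer type — the case used
by Floccari 2024 §5). [cite: Voisin2022FootnotesOGradyMarkman, Thm. 1.5 = Thm. 4.1]
[cite: Floccari2024, proof of the §5.1 Theorem (= Introduction Thm. 3)] -/
theorem kum3Type (h : Voisin2022_kugaSatakeCorrespondence_algebraic_kummerType) {X : SchemeOver ℂ}
    (hX : IsSmoothProjective 6 X) (hK : IsOfGeneralizedKummerType 3 X) :
    IsKSCorrespondenceAlgebraicHK 3 hX :=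
  h 3 (by norm_num) hX hK

/-- The `Kum⁴`-type spelling (dimension `8`; the deformation type of the ladder rung H3 / cell
`hodge-kum4`). [cite: Voisin2022FootnotesOGradyMarkman, Thm. 1.5 = Thm. 4.1] [cite: Floccari2026, §3.3] -/
theorem kum4Type (h : Voisin2022_kugaSatakeCorrespondence_algebraic_kummerType) {X : SchemeOver ℂ}
    (hX : IsSmoothProjective 8 X) (hK : IsOfGeneralizedKummerType 4 X) :
    IsKSCorrespondenceAlgebraicHK 4 hX :=
  h 4 (by norm_num) hX hK

/-- The same through the abbreviation `IsOfGeneralizedKummerSixfoldType` (`= IsOfGeneralizedKummerType 3`,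
file `GeneralizedKummerType`). [cite: Voisin2022FootnotesOGradyMarkman, Thm. 1.5 = Thm. 4.1] -/
theorem of_sixfoldType (h : Voisin2022_kugaSatakeCorrespondence_algebraic_kummerType) {X : SchemeOver ℂ}
    (hX : IsSmoothProjective 6 X) (hK : IsOfGeneralizedKummerSixfoldType X) :
    IsKSCorrespondenceAlgebraicHK 3 hX :=
  h.kum3Type hX hK

end Voisin2022_kugaSatakeCorrespondence_algebraic_kummerType

end Literature.AlgebraicGeometry.Hyperkaehler

end
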